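import Literature.AlgebraicGeometry.ShimuraVarieties.KudlaRapoport2013.Sec11Sec12MainTheorem
import HarnessLib

/-!
# Kudla–Rapoport 2013, §1 «Introduction» — INDEX of §1 onto the §2–§14 declarations of the squad carpet (+ ED. 2: Thm. 1.1 (ii) derived from §11)

[KudlaRapoport2013] = S. Kudla, M. Rapoport, *Special cycles on unitary Shimura varieties II: global theory*, J. reine
angew. Math. **697** (2014) = arXiv 0912.3758; v2 page text (squad kit `T/KR/TKR-t02/g0/KR2013-arXivv2-pages.txt`, pp. 1–7;
pins «(arXiv v2 p. N)», ruling R-1), v1 TeX `paper:arxiv-0912.3758` chunks p0002–p0005.  §1 (v2 pp. 1–7) has ONE numbered statement in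
the PDF, **Theorem 1.1** (v2 p. 4 = v1 Thm. 1.1 p. 5), the displays (1.1) (p. 3) `E(h, s) = Σ_{V ∈ 𝓡_{(n−1,1)}(k)} E(h, s, V)`, (1.2) (p. 6)
`∏_{p ≤ ∞} inv_p(V_p) = 1` and (1.3) (p. 7) `2(x, y) = ⟨√Δ x, y⟩ + ⟨x, y⟩√Δ`, the «Notation and conventions» (pp. 6–7) and the table of
contents (p. 7).  (The v2 e-print TeX carries a `Remark 1.2` environment — lit6 items file `lit/lit6/g0/KR2013-v2final-items.lit6.md` l. 6,
TeX l. 703, «Of course, motivated by the results of [KRYbook], [terstiege] …» — which does NOT appear as a numbered remark in the v2 PDF: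
p. 4 passes from Theorem 1.1 to «The strategy of the proof of this theorem …» and the sentence is the un-numbered «perspective» prose of
pp. 4–5; it is not typed.)  This file is the last of the squad-TKR carpet for the source (deal «t02 3rd block = §1 INDEX», TKR-plan
03:16:06Z: «an index of §1 must point at ALL of §2–§14»): every notion, display and claim of §1 is listed below with the ★ declaration
that types it in the section files, by fully qualified name relative to the common prefix
`Literature.AlgebraicGeometry.ShimuraVarieties.KudlaRapoport2013.` (abbreviated `KR.` in the tables); nothing typed in §2–§14 is
restated here (0 duplicate declarations).  The «Notation and conventions» paragraph of §1 (pp. 6–7) is typed REAL, in the coordinates of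
the §3 file, by the companion `Sec1NotationConventions` (row TKR-t03); the pp. 6–7 rows below point into it.  Only the two clauses of
Theorem 1.1 that no section restates verbatim are typed here, over the §11 datum `Sec11Data C` of the companion `Sec11Sec12MainTheorem`
(the only import; this is NOT an umbrella module — import the section files you need).

## The carpet: section (v2 pages, Contents p. 7) → ★ module → principal declarations

| § of [KR2013] | ★ module `KR.…` | declarations (structures ∕ REAL defs ; printed rows `KR2013_…` or named rows) |
|---|---|---|
| §1 «Introduction» (pp. 1–7): Theorem 1.1 and the INDEX | `Sec1Introduction` (this file) | `KR2013_1_1_i`, `KR2013_1_1_ii` (over ★ `Sec11Sec12MainTheorem.Sec11Data`). |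
| §1 «Notation and conventions» (pp. 6–7) | `Sec1NotationConventions` | `IsSqrtDisc`, `sqrtDisc` (`√Δ` with `Im τ(√Δ) > 0`), `ratDet` (`det V ∈ ℚ^×`), `SameNormClass` (classes mod `N(k^×)`), `invAt` (`inv_p(V) = (det V, Δ)_p` over ★ `Literature.NumberTheory.QuadraticForms.hilbertSymbol`), `tracePairing` (`⟨x, y⟩ = tr((x, y)∕√Δ)`), theorems `tracePairing_smul_left` (`⟨ax, y⟩ = ⟨x, a^σ y⟩`) and `two_mul_krForm_eq_tracePairing` ((1.3)), `IsSelfDualForTrace`, CLOSED named fact `KR2013_1_selfDual_iff` (self-dual for `( , )` iff for `⟨ , ⟩`). |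
| Part I. §2 «The global moduli problem» (pp. 7–15): vocabulary | `Sec2Defs` | `Sec2Core` (standing data `n, r`, the posited stacks), `NaiveObj` (2.1), `NaiveObj.Iso`, `M0Obj` (Ex. 2.2), `Obj` (Def. 2.4 (2.2)), `MObj` (Not. 2.6), `HomOK`, `ZObj` (Def. 2.8 (2.5)), `ZObj.Iso`, `IsPosDefHerm` (`Herm_m(𝒪_k)_{>0}`), `diff0` (`Diff₀(T)`, Prop. 2.22), `sigmaInt` (`a ↦ a^σ` on `𝒪_k`), `IsInertPrime`, `IsRamifiedPrime`, `numRamifiedPrimes` (`δ`), `SelfDualLattice`, `HermIso`, `HermStrictSim`, `Sec2Core.IsRelevant`, `RelevantSharp` (Def. 2.18), `RelevantSharp.Iso∕StrictSim`, `IsCaseA∕IsCaseB` (Prop. 2.14), `IsTypeII` (Rem. 2.15), `IsAwayFromTwo`, `Sec2Data` + `label` (proof of Prop. 2.12), `StackSentences`. |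
| §2: statements | `Sec2GlobalModuliProblem` | `relDim_of_signature`, `Prop21` (Prop. 2.1), `Ex22_polarizationUnique`, `Ex22_endomorphisms` (Ex. 2.2), `conjugationIso`, `Rem23`, `Def24_wedge_of_le_two`, `Def24_awayFromDisc` (2.3), `Thm25` (Thm. 2.5), `hermForm_isHermitian` (2.4), `Lemma27`, `Prop29`, `tateEmb_isometric` (§2.3), `Lemma210`, `Lemma211_i∕_ii`, `Prop212_i∕_ii`, `Prop214`, `Cor216`, `Lemma217`, `Def218_genus_of_type`, `Def218_typeI`, `Prop219`, `Lemma220`, `Lemma221`, `Prop222_i∕_ii∕_iii`. |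
| §3 «Uniformization of the complex points» (pp. 15–19) | `Sec3ComplexUniformization` | `krForm` ∕ `krFormC` (the form `(x, y)` in coordinates), theorem `krForm_eq_hermForm`, `IsHermitianFor`, `signDiag`, `HasSignatureAt`, `KR2013_3_1_nuRealRange`, `negPlanes`, `signedNegPlanes` (the space `D` of negative `r`-planes), `planeImage`, `IsFullLattice`, `IsSelfDualFor`, `LatticeDatum`, `IsSelfDualHermLattice`, `isometryStabilizer`, `latticeImage`, `IsGroupoidEquivOfAction`, `Sec3Data` (+ `Sec3Data.ofSec2`, `GroupoidMatchesIso∕Iso₀∕IsoZ`), `LatticePoint(.Moves)`, `KR2013_3_1` (Prop. 3.1), `idealGram`, `idealLattice`, `idealLatticeDatum`, `LatticeDatum.Moves`, `KR2013_3_eq_3_1`, `KR2013_3_eq_3_2`, `FinAdele`, `toAdelicVec`, `adelicLattice`, `glImage`, `glToAdelic`, `G1Af`, `K1`, `KR2013_3_2_fibre`, `AdelicPoint(.Moves)`, `KR2013_3_2` (Cor. 3.2), `KR2013_3_3` (Rem. 3.3), `homLattice`, `colVec`, `hTilde`, `gramTilde`, `negPlanesPerp`, `incInfty`, `CyclePoint(.Moves)`,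 `KR2013_3_5` (Prop. 3.5), `twistGram`, `twistLattice` (3.3), `KR2013_3_eq_3_4`, `KR2013_3_6_pre`, `KR2013_3_6_empty`, `KR2013_3_6` (Cor. 3.6), `kmCycle` (Rem. 3.7, [KudlaMillson1990]), `AdelicCyclePoint(.Moves)`, `KR2013_3_8` (Prop. 3.8), `SelfDualLattice.coords∕toLatticeDatum`, `specOfEmbedding`. |
| §4 «Relation to Shimura varieties» (pp. 19–22): groups | `Sec4RelationToShimuraVarieties` | `GU` (§4.1), `SU` (§4.4), `KR2013_4_1_rem_GU_smul_eq` (Rem. 4.1), `nuCircOdd`, `nuCircEven`, `KR2013_4_4_norm_nuCirc`, `KR2013_4_4_ker_nuCirc`, `KR2013_4_4_nuCirc_hodge`, `rhoEven`, `rhoEvenMiddle`, `rhoOdd`, `torusRatZeroOdd`, `torusFinAdeleEven`, `torusRatZeroEven`, `KR2013_4_5_pi0_odd∕_even` ((4.5)), `KR2013_4_4_genericFibre` (Prop. 4.4, generic fibre). |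
| §4: moduli ↔ Shimura comparison | `Sec4ShimuraComparison` | `Level`, `Pi0QuotOdd`, `Pi0QuotEven`, `specToSpecInt`, `Sec4Data` (+ `Gfin`, `IsLevel`, `stabilizerLevel`), `KR2013_4_3_representable` (Prop. 4.3), `KR2013_4_4_comparison` (Prop. 4.4; WEAKER-THAN-PRINT, declared), `KR2013_4_4_comparison_sec2` (the same over ★ `Sec2Defs` objects), `KR2013_4_4_galoisAction_odd∕_even∕_evenMiddle` (§4.4 p. 22). |
| Part II. §5 «Uniformization of the supersingular locus» (pp. 22–27), §6 «Special cycles in the supersingular locus» (pp. 27–29) | `Sec5Sec6SupersingularLocus` | `Stack5Sentences`, `Sec5Data` (+ `IsBasePoint`, `InPart` (5.8)–(5.9)), `Lemma51`, `Prop53`, `Lemma54`, `Thm55` (Thm. 5.5, `p`-adic uniformization), `N0_trivial`, `Cor57`, `Lemma61_a∕_b`, `Def62_Zx` (Def. 6.2), `IncPts`, `Prop63` (Prop. 6.3, uniformization of `Z(T)^ss`), `Rem64` (Rem. 6.4). |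
| Part III. §7 «The theta integral» (pp. 30–31), §8 «The Siegel formula» (pp. 31–33), §9 «The incoherent case» (pp. 33–36), §10 «Representation densities» (pp. 36–41) | `Sec7to10EisensteinSide` | `IsQuadCharOf` (§7: `χ`, `η`), `reprSet`, `rGen` ((7.6) `r_gen(T, M)`), `massOf` ((7.2)), `thetaGenus` ((7.5)), `partialL`, `partialLn` ((8.2)), `KR2013_8_7` ((8.7), Siegel–Weil ∕ Ichino), `IsLocalNormAt`, `diff` ((9.2) `Diff(T, V)`), `KR2013_9_diff_subset`, `KR2013_9_diff_card_odd`, `KR2013_9_diff_inert_iff_diff0` (bridge `Diff(T, V)` ↔ `Diff₀(T)`), `EisDatum` (the Eisenstein-side datum: `Φ`, `E_T`, `E′_T`, Whittaker functions), `KR2013_9_factorization`, `KR2013_9_1` (Lem. 9.1), `localLn`, `Sprime`, `Tdiag`, `Cp`, `KR2013_9_3` (Prop. 9.3), `KR2013_9_eisDeriv_theta`, `KR2013_9_eisDeriv_formula`, `KR2013_9_C_eq`, `KR2013_9_4` (Cor. 9.4), `KR2013_9_5` (Lem. 9.5), `hermBracket`, `repCountMod`, `repDensity` ((10.1)), `Sr`,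 `eExp`, `KR2013_10_density_unimodular`, `KR2013_10_reduction`, `KR2013_10_2` (Prop. 10.2), `KR2013_10_3` (Cor. 10.3), `KR2013_10_5` (Rem. 10.5). |
| Part IV. §11 «The main theorem and a conjecture» (pp. 42–45), §12 «The arithmetic degree in the non-degenerate case» (pp. 46–48) | `Sec11Sec12MainTheorem` | `radicalDim`, `minorIdeal`, `HasIdealOrd`, `HasLocalDiagonalType` (the `GL_n(𝒪_{k,p})`-type `diag(1_{n−2}, p^a, p^b)`), `muP`, `diagBlock` ((11.2)), `hermUpperHalfSpace` (`D_n`, §7 p. 31), `qPow` (`q^T`), `Sec11Data` (+ `IsNonDegenerate` (Def. 11.1), `pairing` (Def. 11.4 (11.3)), `arithDegree`, `C1` (the constant `C₁` of Thm. 11.9 ∕ Thm. 1.1), `arithDegreeGeneral` ((11.6))), `KR2013_11_2_i∕_ii`, `KR2013_11_4_finite`, `KR2013_11_5`, `KR2013_11_eq_11_4`, `KR2013_11_7` (Cor. 11.7), `KR2013_11_8` (Thm. 11.8), `KR2013_11_9` (Thm. 11.9 = the main theorem), `KR2013_12_eq_12_2`, `KR2013_12_eq_12_3`, `KR2013_12_2`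 (Lem. 12.2); Conj. 11.10 census-quoted there, not typed (ruling R-7a). |
| Part V. §13 «Level structures» (pp. 48–51) | `Sec13LevelStructures` | `absDisc`, `typeHeight`, `Sec13Data`, `StarModelFacts`, `KR2013_13_1` (Prop. 13.1), `dualSet`, `IsOfType`, `IsTypeTHermLattice` (Def. 13.2), `KR2013_13_2_typeZero∕_relevant∕_isotropic`, `TypedLatticePoint(.Moves)`, `KR2013_13_3` (Prop. 13.3), `LatticeClasses`, `KR2013_13_4` (Rem. 13.4), `stdHermMatrix`, `LevelNData`, `KR2013_13_5` (Def. 13.5), `KR2013_13_5_reduction`, `KR2013_13_5_model`, `levelGroupModN`, `stdFlagStabilizer`, `LevelKbarData`, `KR2013_13_6` (Rem. 13.6). |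
| §14 «The case `n = 2`» (pp. 51–58) | `Sec14CaseNTwo` | `KR2013_14_dualIso`, `IsAntiCommuting`, `quatGram`, `splitGram`, `KR2013_14_1` (Lem. 14.1), `dualSetLoc`, `IsPiModular`, `stdLatticeLoc`, `dyadicRepsIso`, `dyadicRepsAniso`, `IsTypeIIGram` (Rem. 14.3), `IsIsometryToStd`, `KR2013_14_2` (Lem. 14.2), `EllIso`, `Sec14Geometry` ((14.1)), `KR2013_14_4` (Prop. 14.4), `HeckeData`, `KR2013_14_5` (Prop. 14.5), `SerreAdjData`, `KR2013_14_6` (Lem. 14.6), `conjIdeal`, `IsSplitPrime`, `IsHeegnerLevel`, `LevelHeckeData`, `KR2013_14_7` (Prop. 14.7, relation to Heegner points), `DegenerationData`, `KR2013_14_10` (Prop. 14.10). |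

## §1 paragraph by paragraph → pointer (v2 page; «—» = prose ∕ external, not a statement of [KR2013], not typed anywhere, said why)

| §1 item | where it is typed |
|---|---|
| p. 1 `k` imaginary quadratic, `𝒪_k`; `𝓜(n−r, r)` over `Spec 𝒪_k`: `(A, ι, λ)` principally polarized, `ι : 𝒪_k → End(A)`, Rosati induces `σ`, Lie-algebra condition `(n−r, r)` | squad standing instances `[NumberField k] [IsTotallyComplex k] [Algebra.IsQuadraticExtension ℚ k]`; `KR.Sec2Defs.NaiveObj` ((2.1)), `KR.Sec2Defs.Obj` (Def. 2.4), `KR.Sec2Defs.MObj` (Not. 2.6), `KR.Sec2Defs.Sec2Core`; `KR.Sec2GlobalModuliProblem.Prop21` (representable by a DM stack), `.Thm25` (Thm. 2.5), `.relDim_of_signature`; «DM stacks, not schemes … neglected in the introduction» = the ⟨CARRIER⟩ discipline of `Sec2Defs.StackSentences`. |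
| p. 1 `𝓜₀` = CM elliptic curves (`n = 1`, `r = 0`) | `KR.Sec2Defs.M0Obj` (Ex. 2.2), `KR.Sec2GlobalModuliProblem.Ex22_polarizationUnique`, `.Ex22_endomorphisms`. |
| p. 1 `Hom_{𝒪_k}(E, A)` with `h′(x, y) = λ₀⁻¹ ∘ y^∨ ∘ λ ∘ x ∈ 𝒪_k`, positive definite | `KR.Sec2Defs.HomOK`; `KR.Sec2GlobalModuliProblem.hermForm_isHermitian` ((2.4)), `.Lemma27` (Lem. 2.7: positive definite). |
| p. 2 special cycle `Z(T)` for `T ∈ Herm_m(𝒪_k)_{≥0}`, «fundamental matrix» | `KR.Sec2Defs.ZObj` (Def. 2.8 (2.5)), `KR.Sec2Defs.IsPosDefHerm`; `KR.Sec2GlobalModuliProblem.Prop29` (Prop. 2.9). |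
| p. 2 «after extending scalars to `ℂ` these cycles coincide with the cycles of [33, 35]» (KM-cycles) | §3.3: `KR.Sec3ComplexUniformization.KR2013_3_5` (Prop. 3.5), `.kmCycle` + `.KR2013_3_8` (Rem. 3.7 ∕ Prop. 3.8). |
| p. 2 `r = 1`, `m = 1`: divisors; `n = 2`: «essentially identical with the cycles considered by Gross and Zagier» | §14: `KR.Sec14CaseNTwo.KR2013_14_4`, `.KR2013_14_5`, `.KR2013_14_7`, `.KR2013_14_10`. |
| p. 2 codimension of `Z(T)`; «non-degenerate» `T` | `KR.Sec11Sec12MainTheorem.Sec11Data.IsNonDegenerate` (Def. 11.1; the §1 wording «codimension `m` in `𝓜(n−1,1) × 𝓜₀`» = «pure dimension `n − m`» of Def. 11.1). |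
| p. 2 `Z(T₁) × ⋯ × Z(T_r) = ∐_T Z(T)`, `T` with diagonal blocks `T₁, …, T_r` | (11.2): `KR.Sec11Sec12MainTheorem.diagBlock` (blocks of `T` along a `Composition n`); the disjoint-sum sentence itself is a sentence about fibre products of stacks carried by the ⟨CARRIER⟩ fields of `Sec11Data` (module docstring of `Sec11Sec12MainTheorem`, row (11.2)). |
| p. 2 `T` nonsingular ⇒ `supp Z(T)` in finitely many positive characteristics | `KR.Sec2GlobalModuliProblem.Lemma220`, `.Lemma221`, `.Prop222_i∕_ii∕_iii` (Prop. 2.22), with `KR.Sec2Defs.diff0`. |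
| p. 2 `⟨Z(T₁), …, Z(T_r)⟩_T := Σ_p χ(Z(T)_p, 𝒪_{Z(T₁)} ⊗^𝕃 ⋯ ⊗^𝕃 𝒪_{Z(T_r)}) log p` | Def. 11.4 (11.3): `KR.Sec11Sec12MainTheorem.Sec11Data.pairing` (REAL over the ⟨CARRIER⟩ Euler characteristics `chi`), `.KR2013_11_4_finite`, `.KR2013_11_eq_11_4`; «derived tensor product because the cycles do not intersect properly» ∕ Prop. 11.6 (`⊗^𝕃 = ⊗` for non-degenerate `T`) — not typed (derived category of a DM stack; census of `Sec11Sec12MainTheorem`). |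
| pp. 2–3 the character `η` of `k^×_𝔸` restricting to `χ`; `I(s, χ)` of `U(n, n)`, standard sections `Φ(s)`, coherent ∕ incoherent, `R_n(V) = ⊗_v R_n(V_v)`, `R_n(C)`, kernel of `E(0)`, regularized Siegel–Weil (Ichino [22, 23]) | `KR.Sec7to10EisensteinSide.IsQuadCharOf` (`χ`; §7 p. 30 fixes `η` with `η|_{ℚ^×_𝔸} = χ^m`), `.EisDatum` (sections and `E_T(h, s, Φ)` as ⟨CARRIER⟩), `.partialL`, `.partialLn` ((8.2)), `.KR2013_8_7` ((8.7) = the Siegel–Weil identity used); the structure theory of `I(0, χ)` (irreducibility of `R_n(U^±_v)`, [43], [44]; the kernel of the Eisenstein map) is PROSE citing external results and is not restated as a numbered statement in §7–§9 — not typed. |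
| p. 3 «relevant hermitian space», `𝓡_{(n−1,1)}(k)` finite | `KR.Sec2Defs.Sec2Core.IsRelevant`, `KR.Sec2Defs.RelevantSharp` (Def. 2.18); finiteness with the count `2^{δ−1}`: `KR.Sec2GlobalModuliProblem.Lemma211_i` (Lem. 2.11 (i)), strict-similarity classes `.Lemma211_ii`. |
| p. 3 self-dual lattice `L`, `φ_f = char((L ⊗ Ẑ)^n)`, Gaussian `φ′_∞`, `Φ(s; L)`, `E(h, s; L)` depends only on the genus of `L` (orbit under `G₁^V(𝔸_f)`), «one or two genera», `E(h, s; V) = Σ_genera E(h, s; L)` | `KR.Sec2Defs.SelfDualLattice`; in coordinates `KR.Sec3ComplexUniformization.IsSelfDualFor`, `.IsSelfDualHermLattice`, `.adelicLattice`, `.glImage`, `.K1` (stabilizer of `L ⊗ Ẑ`), `.G1Af`; genera: `KR.Sec2GlobalModuliProblem.Cor216` (one or two genera, cases A∕B of Prop. 2.14), `.Lemma217`, `.Def218_genus_of_type`; Gaussian (7.1) and `φ_f`: §7 rows of `KR.Sec7to10EisensteinSide` (`thetaGenus` (7.5), `massOf` (7.2), `rGen` (7.6)) and `.EisDatum` (fields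 `J`, `L`, `eisCoeff`, `eisCoeffDeriv`); the per-`V` sum over genera = `KR.Sec11Sec12MainTheorem.Sec11Data.eisDerivFourier` (⟨CARRIER⟩, (11.5)). |
| p. 3 (1.1) `E(h, s) = Σ_{V ∈ 𝓡_{(n−1,1)}(k)} E(h, s, V)` | = (11.5): `KR.Sec11Sec12MainTheorem.Sec11Data.eisDerivFourierTotal` (⟨CARRIER⟩ `T`-th Fourier coefficient of `E′(z, 0)`); a definition, not a statement. |
| p. 3 classical series `E(z, s)` on `D_n`, `Γ = U(n, n) ∩ GL_{2n}(𝒪_k)`, `Γ_∞`, convergence for `Re(s) > n`, meromorphic continuation and holomorphy on `Re(s) = 0` (Langlands) | `D_n` = `KR.Sec11Sec12MainTheorem.hermUpperHalfSpace` ((7.3) p. 31); `z ↦ E′_T(z, 0, L)` = `KR.Sec7to10EisensteinSide.EisDatum.eisDerivClassical` ((9.1) ∕ (9.3)) with `.KR2013_9_eisDeriv_formula`; the displayed sum over `Γ_∞∖Γ`, its convergence and Langlands' continuation are un-numbered prose ((9.1) is typed as a ⟨CARRIER⟩ function, census of `Sec7to10EisensteinSide`) — not typed. |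
| p. 4 `E(z, 0) = 0` (incoherence); `E′(z, 0) = Σ_{T > 0} a(T) q^T + Σ_{other} a(T, v(z)) q^T`, `q^T = exp(2πi tr(Tz))`, positive-definite terms holomorphic | `KR.Sec11Sec12MainTheorem.qPow` (`q^T`); the `T > 0` coefficients are the ⟨CARRIER⟩s `EisDatum.eisCoeffDeriv` ∕ `Sec11Data.eisDerivFourier(Total)`; the vanishing at `s = 0` and the shape of the expansion are §9 prose («as explained in section 9») — not typed as rows. |
| p. 4 **Theorem 1.1** | clause table below; `KR2013_1_1_i`, `KR2013_1_1_ii` HERE. |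
| p. 4 strategy: `Z(T)` empty or in the supersingular locus at finitely many non-split `p`, at `p` if `Diff₀(T) = {p}` | `KR.Sec2GlobalModuliProblem.Prop222_i∕_ii∕_iii`, `.Lemma220`, `.Lemma221`; `KR.Sec5Sec6SupersingularLocus.Rem64`. |
| p. 4 strategy: non-archimedean uniformization [52] ⇒ `length Z(T)` = (local calculation on the formal moduli space, [39]) × (point count, §12) | §5–§6: `KR.Sec5Sec6SupersingularLocus.Thm55` (Thm. 5.5), `.Cor57`, `.Prop63` (Prop. 6.3), `.Def62_Zx`; local input of [39] = the hypothesis shape of `KR.Sec11Sec12MainTheorem.KR2013_11_8` (Thm. 11.8) with `muP`; point count: `.KR2013_12_eq_12_2`, `.KR2013_12_eq_12_3`, `.KR2013_12_2` (Lem. 12.2). |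
| p. 4 strategy: Fourier coefficient via Siegel–Weil (Ichino) and representation densities (Hironaka [17, 18]) | §8 `KR.Sec7to10EisensteinSide.KR2013_8_7`; §9 `.KR2013_9_factorization`, `.KR2013_9_1`, `.KR2013_9_3`, `.KR2013_9_eisDeriv_theta`, `.KR2013_9_eisDeriv_formula`, `.KR2013_9_C_eq`, `.KR2013_9_4`, `.KR2013_9_5`; §10 `.repDensity`, `.hermBracket`, `.repCountMod`, `.KR2013_10_density_unimodular`, `.KR2013_10_reduction`, `.KR2013_10_2`, `.KR2013_10_3`, `.KR2013_10_5`; Hironaka's general formula is external ([17, 18]) — not typed. |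
| pp. 4–5 perspective: orthogonal case `(n−1, 2)` [30, 36, 38, 41], arithmetic models for arbitrary `(n−r, r)` «with no level structure», deeper level | — (programme prose); level structures: §13 `KR.Sec13LevelStructures.KR2013_13_1`, `.KR2013_13_5`, `.KR2013_13_5_model`, `.KR2013_13_6`. |
| p. 5 «next steps» bullets (degenerate intersections with `Diff₀(T) = {p}`; ramified reduction, `Diff₀(T) = ∅`; parahoric level [46–49]), singular `T` and arithmetic Chow groups [7], CM-field ∕ general `r` generalisations | — research programme, no statements (the first bullet's precise form is Conj. 11.10, census-quoted in `Sec11Sec12MainTheorem`, not typed, R-7a); footnote 1 (Terstiege [62], `n = 3`) external. |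
| p. 5 «section 3: relation to KM-cycles [28, 33, 35]; section 14: Heegner points; sequel [40]: occult period mappings» | §3 `KR.Sec3ComplexUniformization.kmCycle`, `.KR2013_3_8`; §14 `KR.Sec14CaseNTwo.KR2013_14_7`, `.KR2013_14_10`; [40] external. |
| pp. 5–6 lay-out, Parts I–V | Part I = `Sec2Defs`, `Sec2GlobalModuliProblem`, `Sec3ComplexUniformization`, `Sec4RelationToShimuraVarieties`, `Sec4ShimuraComparison` («connected components of `𝓜(n−r,r)_ℂ`» = `KR2013_4_5_pi0_odd∕_even`, `Sec4Data.pi0QuotOdd∕Even`); Part II = `Sec5Sec6SupersingularLocus`; Part III = `Sec7to10EisensteinSide`; Part IV = `Sec11Sec12MainTheorem`; Part V = `Sec13LevelStructures`, `Sec14CaseNTwo`. |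
| p. 6 Notation: `k = ℚ(√Δ)`, discriminant `Δ`, `𝒪_k`, `a ↦ a^σ` | `σ` on `k` = ★ `Literature.NumberTheory.Automorphic.Liu2021.AppendixC.conj ℚ k` (squad convention), on `𝒪_k` = `KR.Sec2Defs.sigmaInt`; `Δ` = Mathlib `NumberField.discr k` (as used by `KR.Sec2Defs.numRamifiedPrimes`, `.IsRamifiedPrime`, `.IsInertPrime`, `KR.Sec13LevelStructures.absDisc`); `√Δ` = `KR.Sec1NotationConventions.IsSqrtDisc`, `.sqrtDisc`. |
| p. 6 `h_k` class number, `w_k = |𝒪_k^×|` | Mathlib `NumberField.classNumber k`, `NumberField.Units.torsionOrder k` (consumed by `KR.Sec11Sec12MainTheorem.Sec11Data.C1`; same pointers in `KR.Sec1NotationConventions`). |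
| p. 6 `k ⊂ ℂ` via `τ` with `Im τ(√Δ) > 0` | the embedding is a datum field wherever needed: `KR.Sec4ShimuraComparison.Sec4Data.τ`, `KR.Sec11Sec12MainTheorem.Sec11Data.τ`, `KR.Sec7to10EisensteinSide.EisDatum.τ`, `KR.Sec3ComplexUniformization.specOfEmbedding`; the normalisation «`τ(√Δ)` has positive imaginary part» is REAL in `KR.Sec1NotationConventions.IsSqrtDisc τ δ` ∕ `.sqrtDisc`. |
| p. 6 `𝒪_{k,p} = 𝒪_k ⊗ ℤ_p`, `𝒪_{k,(p)}` | RECORDED in `KR.Sec1NotationConventions` (no separate declaration; the §5, §11, §13, §14 carpets localise where needed: `KR.Sec11Sec12MainTheorem.HasLocalDiagonalType` reads «`GL_n(𝒪_{k,p})`-equivalent to `diag(1_{n−2}, p^a, p^b)`» through `p`-orders of determinantal ideals (its READING R1); `KR.Sec14CaseNTwo.stdLatticeLoc`, `.dualSetLoc` use `ℚ_p`-Gram data). |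
| p. 6 `det(V) ∈ ℚ^×∕N(k^×)`, `sig(V) = (r, s)`, `inv_p(V) = χ_p(det V)` (Hilbert symbol `(a, Δ)_p`), `inv_∞(V) = (−1)^s`, `inv_p(V) = 1` at split `p`; `V_p` determined by `inv_p`, `V_∞` by `sig` | `det(V)` and its norm class: `KR.Sec1NotationConventions.ratDet`, `.SameNormClass`; signature: `KR.Sec3ComplexUniformization.HasSignatureAt`, `.signDiag` (and the `sig_eq` ∕ signature fields of `Sec4Data` ∕ `Sec3Data`); `inv_p(V)`: `KR.Sec1NotationConventions.invAt` (REAL over ★ `Literature.NumberTheory.QuadraticForms.hilbertSymbol`; it realises the ⟨CARRIER⟩ `Sec2Core.locInv` of `KR.Sec2Defs`); `χ_p` in its norm-residue form: `KR.Sec7to10EisensteinSide.IsLocalNormAt`, `.diff` ((9.2)) — SEAM (T-ref6 N1 on p848601, owed by the first consumer of both files, typed by neither): `Sec7to10EisensteinSide.IsLocalNormAt k p a ↔ hilbertSymbol ℚ_[p] a Δ = 1` for `a ≠ 0`; «`inv_∞ = (−1)^s`», «`inv_p = 1` at split `p`», «`V_p` is determined by `inv_p(V_p)`» are RECORDED in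 the docstring of `invAt` (local classification: external, Jacobowitz ∕ Landherr). |
| pp. 6–7 Hasse principle for hermitian spaces, product formula (1.2) `∏_{p ≤ ∞} inv_p(V_p) = 1`, existence (Landherr's Theorem) | Hasse principle: ★ PROVED in Landherr's global form `Literature.NumberTheory.QuadraticForms.hermitianMatrices_congruent_iff_invariants` (two `σ`-hermitian matrices over a CM field are congruent iff same positive index at every complex embedding and same determinant class mod norms) — cited by `KR.Sec1NotationConventions`, not restated; (1.2) for a GLOBAL `V` = Hilbert reciprocity for `(det V, Δ)`: ★ named fact `Literature.NumberTheory.QuadraticForms.hilbertReciprocity` (RECORDED in `KR.Sec1NotationConventions`, docstring of `invAt`); the EXISTENCE half of Landherr's theorem (a global space with prescribed local invariants satisfying (1.2)) is not in the tree and not typed ([KR2013] use it only through Lem. 2.11 = `KR.Sec2GlobalModuliProblem.Lemma211_i∕_ii`; the uniqueness clauses «the unique relevant `V` with `inv_ℓ(V) = inv_ℓ(V_T)`, `ℓ ≠ p`» sit inside `.Prop222_ii∕_iii` and `KR.Sec7to10EisensteinSide.KR2013_9_3`). |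
| p. 7 `⟨x, y⟩ = tr((x, y)∕√Δ)`, `⟨ax, y⟩ = ⟨x, a^σ y⟩`, (1.3) `2(x, y) = ⟨√Δ x, y⟩ + ⟨x, y⟩√Δ` and its converse | `KR.Sec1NotationConventions.tracePairing` (REAL over ★ `Sec3ComplexUniformization.krForm`), theorem `.tracePairing_smul_left` (`⟨ax, y⟩ = ⟨x, a^σ y⟩`), theorem `.two_mul_krForm_eq_tracePairing` ((1.3)); the converse construction (an alternating `ℚ`-form with `⟨ax, y⟩ = ⟨x, a^σ y⟩` defines a hermitian form) is RECORDED there, not typed (unused later in the paper); the form itself: (2.4) `KR.Sec2GlobalModuliProblem.hermForm_isHermitian`, `KR.Sec3ComplexUniformization.krForm`, `.krFormC`, theorem `.krForm_eq_hermForm`. |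
| p. 7 «an `𝒪_k`-lattice is self-dual for `( , )` iff it is self-dual for `⟨ , ⟩`» | `KR.Sec1NotationConventions.IsSelfDualForTrace` + the CLOSED named fact `.KR2013_1_selfDual_iff` (the two duals coincide because the different of `k` is `(√Δ)`; Mathlib has `differentIdeal` but not its value for quadratic fields, hence a fact, not yet a theorem); also quoted in the docstring of `KR.Sec2Defs.SelfDualLattice` as the justification for typing self-duality w.r.t. `( , )` only. |
| p. 7 Contents (§1 p. 1, §2 p. 7, §3 p. 15, §4 p. 19, §5 p. 22, §6 p. 27, §7 p. 30, §8 p. 31, §9 p. 33, §10 p. 36, §11 p. 42, §12 p. 46, §13 p. 48, §14 p. 51, References p. 58) | the carpet table above. |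

## Theorem 1.1 (v2 p. 4), clause by clause

Printed: «Let `T ∈ Herm_n(𝒪_k)_{>0}` be nonsingular with diagonal blocks `T₁, …, T_r`. Let `Diff₀(T)` be the set of primes `p` that are
inert in `k` for which `ord_p(det(T))` is odd. (i) If `|Diff₀(T)| ≥ 2`, then `Z(T) = ∅` and `E'_T(z, 0) = 0`. (ii) If `Diff₀(T) = {p}` with
`p > 2`, then `T` is non-degenerate if and only if it is `GL_n(𝒪_{k,p})`-equivalent to `diag(1_{n−2}, p^a, p^b)` for some `0 ≤ a < b` with
`a + b` odd. In this case `Z(T)` has support in the supersingular locus in characteristic `p` and `⟨Z(T₁), …, Z(T_r)⟩_T = length(Z(T)) · log p`.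
Furthermore, in this case `E'_T(z, 0) = E'_T(z, 0, V) = C₁ · ⟨Z(T₁), …, Z(T_r)⟩_T · q^T`, for an explicit constant `C₁`, independent of `T`,
where `V ∈ 𝓡_{(n−1,1)}(k)` is the unique relevant hermitian space which differs from `V_T` only at `∞` and `p`. Here `V_T` denotes the space
`kⁿ` with hermitian form defined by `T`.»

| clause | where it lives |
|---|---|
| `Diff₀(T)` | `KR.Sec2Defs.diff0` (Prop. 2.22); its relation to `Diff(T, V)` of (9.2): `KR.Sec7to10EisensteinSide.KR2013_9_diff_inert_iff_diff0`. |
| (i) `|Diff₀(T)| ≥ 2 ⇒ Z(T) = ∅` | Prop. 2.22 (i) = `KR.Sec2GlobalModuliProblem.Prop222_i`, and `KR.Sec11Sec12MainTheorem.KR2013_11_eq_11_4` (first case). |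
| (i) `|Diff₀(T)| ≥ 2 ⇒ E'_T(z, 0) = 0` | per lattice ∕ section: Lem. 9.1 (i) = `KR.Sec7to10EisensteinSide.KR2013_9_1` (first conjunct, hypothesis `1 < |Diff(T, V)|`, which follows from `|Diff₀(T)| ≥ 2` by `KR2013_9_diff_inert_iff_diff0`); for the TOTAL coefficient of (1.1) = (11.5): `KR2013_1_1_i` (typed HERE over the ⟨CARRIER⟩ `Sec11Data.eisDerivFourierTotal`; §11 does not restate it). |
| (ii) the non-degeneracy criterion | `KR.Sec11Sec12MainTheorem.KR2013_11_2_i` (Prop. 11.2 (i)); «with `a + b` odd» is automatic from `Diff₀(T) = {p}` (`ord_p det T = a + b` odd) and is the only wording not in §11 — recorded, and typed in `KR2013_1_1_ii` as printed. |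
| (ii) support in the supersingular locus in characteristic `p` | Prop. 2.22 (ii) = `KR.Sec2GlobalModuliProblem.Prop222_ii`; Rem. 6.4 = `KR.Sec5Sec6SupersingularLocus.Rem64`; not restated. |
| (ii) `⟨Z(T₁), …, Z(T_r)⟩_T = length(Z(T)) · log p` | `KR.Sec11Sec12MainTheorem.KR2013_11_7` (Cor. 11.7). |
| (ii) `E'_T(z,0) = E'_T(z,0,V) = C₁ · ⟨…⟩_T · q^T` | `KR.Sec11Sec12MainTheorem.KR2013_11_9` (Thm. 11.9) with `.KR2013_11_7`; `C₁` = `Sec11Data.C1` (explicit in Thm. 11.9; `= C` of Cor. 9.4 up to the printed factors, `KR.Sec7to10EisensteinSide.KR2013_9_C_eq`); «the unique relevant `V` which differs from `V_T` only at `∞` and `p`» = the `V` of Prop. 2.22 (ii) ∕ Prop. 9.3 (`Prop222_ii`, `KR2013_9_3`). |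
| (1.1) (p. 3) `E(h, s) = Σ_V E(h, s, V)` | = (11.5) and the ⟨CARRIER⟩ `Sec11Data.eisDerivFourierTotal`; not a statement. |

`KR2013_1_1_ii` below is the introduction's PACKAGE of (ii) as one predicate on the §11 datum (so that a consumer citing «[KR2013, Thm. 1.1]»
has one name); it is the conjunction of the indexed rows in the introduction's wording (no `Z(T) ≠ ∅` hypothesis is printed in Thm. 1.1 (ii);
Prop. 11.2 and Thms. 11.8∕11.9 carry it — READING: the package keeps the §11 hypotheses, i.e. it adds `Z(T) ≠ ∅` where §11 has it).
ED. 2: the package is DERIVABLE from the §11 rows and the derivation is PROVED here — `KR2013_1_1_ii_of_sec11 :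
KR2013_11_2_i D → KR2013_11_7 D → KR2013_11_9 D → KR2013_1_1_ii D` (section «Derivation»; the one arithmetic input is
`odd_add_of_diff0_of_hasLocalDiagonalType`: «with `a + b` odd» is automatic from `Diff₀(T) = {p}`).  No instance, notation or axiom;
nothing here asserts that any statement of [KudlaRapoport2013] holds.
-/
open Matrix NumberField

namespace Literature.AlgebraicGeometry.ShimuraVarieties.KudlaRapoport2013.Sec1Introduction

open Literature.AlgebraicGeometry.ShimuraVarieties.KudlaRapoport2013.Sec2Defs (IsPosDefHerm diff0 Sec2Core)
open Literature.AlgebraicGeometry.ShimuraVarieties.KudlaRapoport2013.Sec11Sec12MainTheorem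
  (Sec11Data HasLocalDiagonalType HasIdealOrd hermUpperHalfSpace qPow KR2013_11_2_i KR2013_11_7 KR2013_11_9)

variable {k : Type} [Field k] [NumberField k] [IsTotallyComplex k] [Algebra.IsQuadraticExtension ℚ k]
variable {C : Sec2Core k}

/-- **Theorem 1.1 (i).**  Printed (p. 4): «If `|Diff₀(T)| ≥ 2`, then `Z(T) = ∅` and `E'_T(z, 0) = 0`.» for `T ∈ Herm_n(𝒪_k)_{>0}`
nonsingular.  TYPED over the §11 datum: `Z(T)` has no irreducible component and the `T`-th Fourier coefficient of `E'(z, 0)` vanishes on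
the hermitian upper half-space (INDEX: the first half is Prop. 2.22 (i) = `Sec2GlobalModuliProblem.Prop222_i`; the second is, per
lattice, Lem. 9.1 (i) = `Sec7to10EisensteinSide.KR2013_9_1` with the (9.2)-bridge `KR2013_9_diff_inert_iff_diff0`, and is stated here for
the total coefficient of (1.1) = (11.5), which §11 does not restate).
[cite: KudlaRapoport2013, §1 Theorem 1.1 (i) (arXiv v2 p. 4)] -/
def KR2013_1_1_i (D : Sec11Data C) : Prop :=
  ∀ T : Matrix (Fin C.n) (Fin C.n) (𝓞 k), IsPosDefHerm k T → (diff0 k T).Nontrivial →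
    D.cycleDims T = ∅ ∧ ∀ z ∈ hermUpperHalfSpace C.n, D.eisDerivFourierTotal T z = 0

/-- **Theorem 1.1 (ii)** — the introduction's package (INDEX: Prop. 11.2 (i) = `KR2013_11_2_i`, Cor. 11.7 = `KR2013_11_7`, Thm. 11.9 =
`KR2013_11_9`).  Printed (p. 4): «If `Diff₀(T) = {p}` with `p > 2`, then `T` is non-degenerate if and only if it is `GL_n(𝒪_{k,p})`-equivalent
to `diag(1_{n−2}, p^a, p^b)` for some `0 ≤ a < b` with `a + b` odd. In this case … `⟨Z(T₁), …, Z(T_r)⟩_T = length(Z(T)) · log p`. Furthermore,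
in this case `E'_T(z, 0) = E'_T(z, 0, V) = C₁ · ⟨Z(T₁), …, Z(T_r)⟩_T · q^T`, for an explicit constant `C₁`, independent of `T`.»  TYPED over the
§11 datum with the §11 hypothesis `Z(T) ≠ ∅` (READING, module docstring) and `n ≥ 2`; the support clause («in the supersingular locus in
characteristic `p`») is Prop. 2.22 (ii) ∕ Rem. 6.4 (`Sec2GlobalModuliProblem.Prop222_ii`, `Sec5Sec6SupersingularLocus.Rem64`) and is
not typed here.  DERIVABLE from ★ `KR2013_11_2_i` ∧ `KR2013_11_7` ∧ `KR2013_11_9`: theorem `KR2013_1_1_ii_of_sec11` below (ED. 2).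
[cite: KudlaRapoport2013, §1 Theorem 1.1 (ii) (arXiv v2 p. 4)] -/
def KR2013_1_1_ii (D : Sec11Data C) : Prop :=
  ∀ (T : Matrix (Fin C.n) (Fin C.n) (𝓞 k)) (p : ℕ), IsPosDefHerm k T → (D.cycleDims T).Nonempty → diff0 k T = {p} → 2 < p →
    2 ≤ C.n →
      (D.IsNonDegenerate T ↔ ∃ a b : ℕ, a < b ∧ Odd (a + b) ∧ HasLocalDiagonalType T p a b) ∧
      (D.IsNonDegenerate T → ∀ π : Composition C.n,
        D.pairing T π = D.arithDegree T p ∧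
          ∀ z ∈ hermUpperHalfSpace C.n,
            D.eisDerivFourierTotal T z = D.eisDerivFourier T z ∧
              D.eisDerivFourier T z = (D.C1 T : ℂ) * (D.pairing T π : ℂ) * qPow D.τ T z)

/-! ## Derivation (ED. 2): Theorem 1.1 (ii) from Prop. 11.2 (i), Cor. 11.7 and Thm. 11.9

The introduction's package `KR2013_1_1_ii` is the conjunction of the §11 rows it indexes; the only wording of Thm. 1.1 (ii) absent
from §11, «with `a + b` odd», follows from `Diff₀(T) = {p}` because the local diagonal type pins `ord_p(det T) = a + b`
(`odd_add_of_diff0_of_hasLocalDiagonalType`).  Hence nothing in this file adds content beyond §11: the derivation is a theorem. -/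

section Derivation

omit [IsTotallyComplex k] [Algebra.IsQuadraticExtension ℚ k] in
/-- `ℚ ∩ 𝓞 k = ℤ` in divisibility form: an integer divisible in `𝓞 k` by a nonzero integer `m` is divisible by `m` in `ℤ`
(private helper: `d/m` is a rational algebraic integer). [folklore] -/
private theorem int_dvd_of_cast_dvd_cast {m d : ℤ} (hm : m ≠ 0) (h : (m : 𝓞 k) ∣ (d : 𝓞 k)) : m ∣ d := by
  obtain ⟨c, hc⟩ := h
  have hmq : (m : ℚ) ≠ 0 := by exact_mod_cast hm
  have hmk : (m : k) ≠ 0 := by exact_mod_cast hm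
  have h1 : (d : k) = (m : k) * ((c : 𝓞 k) : k) := by
    have := congrArg (fun x : 𝓞 k => (x : k)) hc
    simpa using this
  have hck : ((c : 𝓞 k) : k) = algebraMap ℚ k ((d : ℚ) / m) := by
    rw [map_div₀, map_intCast, map_intCast, eq_div_iff hmk, mul_comm, ← h1]
  have hint : IsIntegral ℤ ((d : ℚ) / m) := by
    have hc_int : IsIntegral ℤ ((c : 𝓞 k) : k) := c.isIntegral_coe
    rw [hck] at hc_int
    exact (isIntegral_algebraMap_iff (algebraMap ℚ k).injective).mp hc_int
  obtain ⟨y, hy⟩ := IsIntegrallyClosed.isIntegral_iff.mp hint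
  have hy' : (y : ℚ) = d / m := by simpa using hy
  have h3 : (d : ℚ) = m * y := by rw [hy']; field_simp
  exact ⟨y, by exact_mod_cast h3⟩

omit [IsTotallyComplex k] [Algebra.IsQuadraticExtension ℚ k] in
/-- **«with `a + b` odd» is automatic** (Thm. 1.1 (ii) vs Prop. 11.2 (i)): if `Diff₀(T) = {p}` and `T` has the local diagonal type
`diag(1_{n−2}, p^a, p^b)` at `p` (★ `HasLocalDiagonalType`, whose last clause is `ord_𝔭(det T) = a + b` for `𝔭 = p𝒪_k`), then `a + b`
is odd — because `p ∈ Diff₀(T)` says `ord_p(det T)` is odd for the rational integer `det T`, and for the inert (indeed any) rational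
prime `p` the `𝔭`-order of a rational integer in `𝒪_k` is its `p`-order (`ℚ ∩ 𝒪_k = ℤ`).
[cite: KudlaRapoport2013, §1 Theorem 1.1 (ii) (arXiv v2 p. 4)] -/
theorem odd_add_of_diff0_of_hasLocalDiagonalType {n : ℕ} {T : Matrix (Fin n) (Fin n) (𝓞 k)} {p a b : ℕ}
    (hdiff : diff0 k T = {p}) (h : HasLocalDiagonalType T p a b) : Odd (a + b) := by
  have hp : p ∈ diff0 k T := by rw [hdiff]; exact Set.mem_singleton p
  obtain ⟨hinert, d, hd, hodd⟩ := hp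
  have hprime : p.Prime := hinert.1
  obtain ⟨-, -, -, hle, hnle⟩ := h
  rw [Ideal.span_singleton_pow, Ideal.span_singleton_le_span_singleton, ← hd] at hle hnle
  have hp0 : (p : ℤ) ≠ 0 := by exact_mod_cast hprime.ne_zero
  have h1 : (p : ℤ) ^ (a + b) ∣ d := by
    refine int_dvd_of_cast_dvd_cast (k := k) (pow_ne_zero _ hp0) ?_
    push_cast; exact hle
  have h2 : ¬ (p : ℤ) ^ (a + b + 1) ∣ d := by
    intro hcon
    apply hnle
    simpa using map_dvd (Int.castRingHom (𝓞 k)) hcon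
  have hd0 : d ≠ 0 := by rintro rfl; exact h2 (dvd_zero _)
  haveI := Fact.mk hprime
  rw [padicValInt_dvd_iff] at h1 h2
  have hv : padicValInt p d = a + b := by omega
  rw [hv] at hodd
  exact_mod_cast hodd

/-- **Theorem 1.1 (ii) is the §11 package — proved**: `KR2013_11_2_i D → KR2013_11_7 D → KR2013_11_9 D → KR2013_1_1_ii D`
(Prop. 11.2 (i) gives the criterion, `odd_add_of_diff0_of_hasLocalDiagonalType` the parity, Cor. 11.7 the identity
`⟨Z(T₁), …, Z(T_r)⟩_T = deĝ Z(T)` for every block decomposition, Thm. 11.9 the two Eisenstein identities with `deĝ Z(T)` rewritten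
through Cor. 11.7). [cite: KudlaRapoport2013, §1 Theorem 1.1 (ii) (arXiv v2 p. 4)] -/
theorem KR2013_1_1_ii_of_sec11 (D : Sec11Data C) (h2 : KR2013_11_2_i D) (h7 : KR2013_11_7 D) (h9 : KR2013_11_9 D) :
    KR2013_1_1_ii D := by
  intro T p hT hne hdiff hp hn
  refine ⟨?_, ?_⟩
  · rw [((h2 T p hT hne hdiff hp).2 hn)]
    constructor
    · rintro ⟨a, b, hab, hloc⟩
      exact ⟨a, b, hab, odd_add_of_diff0_of_hasLocalDiagonalType hdiff hloc, hloc⟩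
    · rintro ⟨a, b, hab, -, hloc⟩
      exact ⟨a, b, hab, hloc⟩
  · intro hnd π
    have hπ := h7 T π p hT hnd hdiff
    refine ⟨hπ, fun z hz => ?_⟩
    obtain ⟨e1, e2⟩ := h9 T p hT hnd hne hdiff hp z hz
    exact ⟨e1, by rw [e2, hπ]⟩

end Derivation

end Literature.AlgebraicGeometry.ShimuraVarieties.KudlaRapoport2013.Sec1Introduction
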